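import Mathlib.Data.Nat.Factorization.Induction
import Summits.KontsevichZagierPeriods.KontsevichZagierPeriods.Theorems.HurwitzMicroSectorsNormalFormPrincipleDlogMoves
import Summits.KontsevichZagierPeriods.KontsevichZagierPeriods.Theorems.HurwitzMicroSectorsNormalFormPrincipleSplitMoves

/-!
# `NormalFormPrinciple` (stmt-KontsevichZagierPeriods-3869), line `SketchIdeator1`, leaf
# `stub_boxRigidity` in dimension one — the registered sub-goal `nf_pole_one`
# (explicit / elementary route)

Pure proof file (`--supports` the crux stmt-KontsevichZagierPeriods-3869). It proves the
registered sub-goal `nf_pole_one` of the split-denominator layer BY NAME AND SIGNATURE, in the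
sub-namespace `…PiBox.Dlog.K22` (siege attempt k22, explicit / elementary route):

a simple rational pole off the closed unit interval, `T = [(0,1), c/(x − ρ)]` with `c, ρ ∈ ℚ`,
`ρ ∉ [0,1]`, is, in `FormalRep ⧸ KZ.relations`, in the normal form
"rational point + prime carriers":

  `[T] = [pt, r] + Σ_{p ∈ S} [(1,p), C_p / y]`, `S` a finite set of primes, `C` supported on `S`

(here with `r = 0`, `S` = the prime factors of the numerators of the cleared end points, and
`C_p = (v_p(n_b) − v_p(n_a))·c'`).

The route is completely explicit and uses only the four moves already landed for the dlog family
(`…DlogMoves.lean`: splitting, scaling, merging, empty slab, zero integrand) and the affine move of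
`…SplitMoves.lean`:

1. one affine move (rule 2): the translation `x ↦ x − ρ` (`ρ < 0`) or the reflection `x ↦ ρ − x`
   (`ρ > 1`) carries `T` to a dlog representation `[(a,b), c'/y]` with rational `0 < a < b`
   (`pole_translate_mem_relations`, `pole_reflect_mem_relations`);
2. the dilation by a common denominator `d` (rule 2) makes the ends natural numbers
   `n_a = d a < n_b = d b` (`exists_nat_clear_denominators`, `dlog_scale_mem_relations`);
3. splitting at the integers (rule 1a) gives `[(n_a,n_b)] = Λ(n_b) − Λ(n_a)` with the carriers
   `Λ(n, c) := [(1,n), c/y]`, and `Λ` is additive on products (`carrier_mul`: split at `m`, rescale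
   `(m, mn) → (1, n)`), so `Λ(n, c) = Σ_p v_p(n) • Λ(p, c)` by induction over `Nat.recOnMul`
   (`carrier_eq_sum_factorization`);
4. `u ↦ Λ(p, u)` is additive modulo relations (merging, rule 1b), hence `ℤ`-linear
   (`carrier_zsmul`), which converts the integer multiplicities into the coefficients `C_p`.

No arithmetic input is needed (the statement is an identity in the quotient, not a vanishing
statement). Sources: M. Kontsevich, D. Zagier, *Periods* (2001), §1.1 (`log 2 = ∫₁² dx/x`),
§1.2 rules (1), (2). No definitions are introduced.
-/

noncomputable section

open MeasureTheory Set Finset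
open Literature.NumberTheory.Transcendental Literature.NumberTheory.Transcendental.KZ

namespace Summit.KontsevichZagierPeriods.HurwitzMicroSectors.NormalFormPrinciple.PiBox

namespace Dlog

namespace K22

/-! ## Bookkeeping in the quotient `FormalRep ⧸ relations` -/

/-- A relation is zero in the quotient. [cite: KontsevichZagier2001, §1.2] -/
theorem mk_eq_zero_of_mem {x : FormalRep} (h : x ∈ relations) :
    QuotientAddGroup.mk' relations x = 0 :=
  (QuotientAddGroup.eq_zero_iff x).mpr h

/-- Two formal combinations differing by a relation have the same class.
[cite: KontsevichZagier2001, §1.2] -/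
theorem mk_eq_mk_of_sub_mem {x y : FormalRep} (h : x - y ∈ relations) :
    QuotientAddGroup.mk' relations x = QuotientAddGroup.mk' relations y := by
  rw [← sub_eq_zero, ← map_sub]
  exact mk_eq_zero_of_mem h

/-- A three-term relation `x − y − z ∈ relations` read in the quotient: `[x] = [y] + [z]`.
[cite: KontsevichZagier2001, §1.2] -/
theorem mk_eq_add_of_sub_sub_mem {x y z : FormalRep} (h : x - y - z ∈ relations) :
    QuotientAddGroup.mk' relations x =
      QuotientAddGroup.mk' relations y + QuotientAddGroup.mk' relations z := by
  have h' := mk_eq_zero_of_mem h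
  rwa [map_sub, map_sub, sub_sub, sub_eq_zero] at h'

/-! ## Step 1: the affine move from the pole to a dlog representation -/

section Moves

variable {R : ℚ → ℚ → ℚ → IntegralRep 1}

/-- **Translation** (rule 2). For `ρ < 0` the translation `x ↦ x − ρ` carries
`[(0,1), c/(x − ρ)]` to the dlog representation `[(−ρ, 1 − ρ), c/y]`.
[cite: KontsevichZagier2001, §1.2 rule (2)] -/
theorem pole_translate_mem_relations
    (hR : ∀ a b c, 0 < a → (R a b c).domain = {x | x 0 ∈ Set.Ioo (a:ℝ) b} ∧
      (R a b c).integrand = fun x => (c:ℝ) / x 0)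
    {c ρ : ℚ} (hρ : ρ < 0) (T : IntegralRep 1) (hTd : T.domain = {x | x 0 ∈ Set.Ioo (0:ℝ) 1})
    (hTi : EqOn T.integrand (fun x => (c:ℝ) / (x 0 - ρ)) T.domain) :
    of T - of (R (-ρ) (1 - ρ) c) ∈ relations := by
  obtain ⟨hDd, hDi⟩ := hR (-ρ) (1 - ρ) c (neg_pos.mpr hρ)
  refine affine_sub_mem_relations (s := 1) (t := -ρ) one_ne_zero T (R (-ρ) (1 - ρ) c)
    (fun y => (c:ℝ) / y) ?_ ?_ ?_
  · rw [hTd, image_affine_slab_of_pos (by norm_num : (0:ℝ) < ((1:ℚ):ℝ)), hDd]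
    ext x
    simp only [Set.mem_setOf_eq, Set.mem_Ioo]
    push_cast
    constructor <;> rintro ⟨h1, h2⟩ <;> constructor <;> linarith
  · rw [hDi]
    exact fun x _ => rfl
  · intro x hx
    rw [hTi hx]
    push_cast
    simp only [abs_one, mul_one, one_mul, sub_eq_add_neg]

/-- **Reflection** (rule 2). For `1 < ρ` the reflection `x ↦ ρ − x` carries
`[(0,1), c/(x − ρ)]` to the dlog representation `[(ρ − 1, ρ), (−c)/y]`.
[cite: KontsevichZagier2001, §1.2 rule (2)] -/
theorem pole_reflect_mem_relations
    (hR : ∀ a b c, 0 < a → (R a b c).domain = {x | x 0 ∈ Set.Ioo (a:ℝ) b} ∧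
      (R a b c).integrand = fun x => (c:ℝ) / x 0)
    {c ρ : ℚ} (hρ : 1 < ρ) (T : IntegralRep 1) (hTd : T.domain = {x | x 0 ∈ Set.Ioo (0:ℝ) 1})
    (hTi : EqOn T.integrand (fun x => (c:ℝ) / (x 0 - ρ)) T.domain) :
    of T - of (R (ρ - 1) ρ (-c)) ∈ relations := by
  obtain ⟨hDd, hDi⟩ := hR (ρ - 1) ρ (-c) (by linarith)
  refine affine_sub_mem_relations (s := -1) (t := ρ) (by norm_num) T (R (ρ - 1) ρ (-c))
    (fun y => ((-c : ℚ):ℝ) / y) ?_ ?_ ?_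
  · rw [hTd, image_affine_slab_of_neg (by norm_num : ((-1:ℚ):ℝ) < 0), hDd]
    ext x
    simp only [Set.mem_setOf_eq, Set.mem_Ioo]
    push_cast
    constructor <;> rintro ⟨h1, h2⟩ <;> constructor <;> linarith
  · rw [hDi]
    exact fun x _ => rfl
  · intro x hx
    rw [hTi hx]
    have hx' : ((-1:ℚ):ℝ) * x 0 + (ρ:ℝ) = -(x 0 - ρ) := by push_cast; ring
    simp only [hx']
    push_cast
    rw [neg_div_neg_eq, abs_neg, abs_one, mul_one]

/-! ## Step 2: clearing denominators -/

/-- Two positive rationals have a common denominator `d` making both of them natural numbers.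
[folklore] -/
theorem exists_nat_clear_denominators {a b : ℚ} (ha : 0 < a) (hb : 0 < b) :
    ∃ d na nb : ℕ, 0 < d ∧ (na:ℚ) = d * a ∧ (nb:ℚ) = d * b := by
  refine ⟨a.den * b.den, a.num.natAbs * b.den, b.num.natAbs * a.den,
    Nat.mul_pos a.den_pos b.den_pos, ?_, ?_⟩
  · have h := Rat.mul_den_eq_num a
    rw [Nat.cast_mul, Nat.cast_natAbs, abs_of_pos (Rat.num_pos.mpr ha)] at *
    push_cast
    linear_combination (-(b.den:ℚ)) * h
  · have h := Rat.mul_den_eq_num b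
    rw [Nat.cast_mul, Nat.cast_natAbs, abs_of_pos (Rat.num_pos.mpr hb)] at *
    push_cast
    linear_combination (-(a.den:ℚ)) * h

/-! ## Step 3: the carriers `Λ(n, c) = [(1,n), c/y]` and their multiplicativity -/

/-- **The empty carrier**: `Λ(1, c) = [(1,1), c/y]` is a relation (empty slab).
[cite: KontsevichZagier2001, §1.2 rule (1)] -/
theorem carrier_one_mem_relations
    (hR : ∀ a b c, 0 < a → (R a b c).domain = {x | x 0 ∈ Set.Ioo (a:ℝ) b} ∧
      (R a b c).integrand = fun x => (c:ℝ) / x 0)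
    (c : ℚ) : of (R 1 ((1:ℕ):ℚ) c) ∈ relations :=
  slab_empty_mem_relations (R 1 ((1:ℕ):ℚ) c) (hR 1 ((1:ℕ):ℚ) c one_pos).1 (by norm_num)

/-- **Multiplicativity of the carriers**: for `m, n ≥ 1`,
`Λ(mn, c) − Λ(m, c) − Λ(n, c) ∈ relations` — split `(1, mn)` at `m` (rule 1a) and rescale
`(m, mn) → (1, n)` by the dilation `y ↦ m y` (rule 2). [cite: KontsevichZagier2001, §1.2] -/
theorem carrier_mul_mem_relations
    (hR : ∀ a b c, 0 < a → (R a b c).domain = {x | x 0 ∈ Set.Ioo (a:ℝ) b} ∧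
      (R a b c).integrand = fun x => (c:ℝ) / x 0)
    {m n : ℕ} (hm : m ≠ 0) (hn : n ≠ 0) (c : ℚ) :
    of (R 1 ((m * n : ℕ):ℚ) c) - of (R 1 (m:ℚ) c) - of (R 1 (n:ℚ) c) ∈ relations := by
  have hm0 : (0:ℚ) < m := Nat.cast_pos.mpr (Nat.pos_of_ne_zero hm)
  obtain ⟨hd, hi⟩ := hR 1 ((m * n : ℕ):ℚ) c one_pos
  obtain ⟨hd₁, hi₁⟩ := hR 1 (m:ℚ) c one_pos
  obtain ⟨hd₂, hi₂⟩ := hR (m:ℚ) ((m * n : ℕ):ℚ) c hm0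
  obtain ⟨hd₃, hi₃⟩ := hR 1 (n:ℚ) c one_pos
  -- splitting at `m`
  have hsplit : of (R 1 ((m * n : ℕ):ℚ) c) - of (R 1 (m:ℚ) c) - of (R (m:ℚ) ((m * n : ℕ):ℚ) c) ∈
      relations := by
    refine split_mem_relations _ _ _ hd hd₁ hd₂ ?_ ?_ ?_ ?_
    · exact_mod_cast Nat.one_le_iff_ne_zero.mpr hm
    · exact_mod_cast Nat.le_mul_of_pos_right m (Nat.pos_of_ne_zero hn)
    · rw [hi₁, hi]
      exact fun _ _ => rfl
    · rw [hi₂, hi]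
      exact fun _ _ => rfl
  -- rescaling `(m, mn) → (1, n)`
  have hscale : of (R 1 (n:ℚ) c) - of (R (m:ℚ) ((m * n : ℕ):ℚ) c) ∈ relations := by
    refine dlog_scale_mem_relations (c := c) (s := (m:ℚ)) _ _ hd₃ ?_ ?_ ?_ one_pos hm0
    · rw [hd₂, mul_one, Nat.cast_mul]
    · rw [hi₃]
      exact fun _ _ => rfl
    · rw [hi₂]
      exact fun _ _ => rfl
  have : of (R 1 ((m * n : ℕ):ℚ) c) - of (R 1 (m:ℚ) c) - of (R 1 (n:ℚ) c) =
      (of (R 1 ((m * n : ℕ):ℚ) c) - of (R 1 (m:ℚ) c) - of (R (m:ℚ) ((m * n : ℕ):ℚ) c)) -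
        (of (R 1 (n:ℚ) c) - of (R (m:ℚ) ((m * n : ℕ):ℚ) c)) := by abel
  rw [this]
  exact relations.sub_mem hsplit hscale

/-- **Factorisation of the carriers**: for `n ≠ 0` and any finite `S ⊇` the prime factors of
`n`, `[Λ(n, c)] = Σ_{p ∈ S} v_p(n) • [Λ(p, c)]` in `FormalRep ⧸ relations` (induction over
`Nat.recOnMul` from the empty carrier and multiplicativity). [cite: KontsevichZagier2001, §1.2] -/
theorem carrier_eq_sum_factorization
    (hR : ∀ a b c, 0 < a → (R a b c).domain = {x | x 0 ∈ Set.Ioo (a:ℝ) b} ∧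
      (R a b c).integrand = fun x => (c:ℝ) / x 0)
    (c : ℚ) : ∀ n : ℕ, n ≠ 0 → ∀ S : Finset ℕ, n.primeFactors ⊆ S →
      QuotientAddGroup.mk' relations (of (R 1 (n:ℚ) c)) =
        ∑ p ∈ S, (n.factorization p) • QuotientAddGroup.mk' relations (of (R 1 (p:ℚ) c)) := by
  intro n
  induction n using Nat.recOnMul with
  | zero => exact fun h => absurd rfl h
  | one =>
    intro _ S _
    rw [mk_eq_zero_of_mem (carrier_one_mem_relations hR c), Nat.factorization_one]
    simp
  | prime p hp =>
    intro _ S hS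
    have hpS : p ∈ S := hS (by rw [hp.primeFactors]; exact Finset.mem_singleton_self p)
    rw [hp.factorization, Finset.sum_eq_single_of_mem p hpS fun q _ hq => by
      rw [Finsupp.single_eq_of_ne hq, zero_smul]]
    rw [Finsupp.single_eq_same, one_smul]
  | mul a b iha ihb =>
    intro hab S hS
    obtain ⟨ha, hb⟩ := Nat.mul_ne_zero_iff.mp hab
    rw [Nat.primeFactors_mul ha hb] at hS
    rw [mk_eq_add_of_sub_sub_mem (carrier_mul_mem_relations hR ha hb c),
      iha ha S fun p hp => hS (Finset.mem_union_left _ hp),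
      ihb hb S fun p hp => hS (Finset.mem_union_right _ hp),
      Nat.factorization_mul ha hb, ← Finset.sum_add_distrib]
    refine Finset.sum_congr rfl fun p _ => ?_
    rw [Finsupp.add_apply, add_smul]

/-! ## Step 4: linearity of the carriers in the coefficient -/

/-- **Merging**: `u ↦ [Λ(n, u)]` is additive, `[Λ(n, u + v)] = [Λ(n, u)] + [Λ(n, v)]`
(rule 1b). [cite: KontsevichZagier2001, §1.2 rule (1)] -/
theorem carrier_add
    (hR : ∀ a b c, 0 < a → (R a b c).domain = {x | x 0 ∈ Set.Ioo (a:ℝ) b} ∧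
      (R a b c).integrand = fun x => (c:ℝ) / x 0)
    (n : ℕ) (u v : ℚ) :
    QuotientAddGroup.mk' relations (of (R 1 (n:ℚ) (u + v))) =
      QuotientAddGroup.mk' relations (of (R 1 (n:ℚ) u)) +
        QuotientAddGroup.mk' relations (of (R 1 (n:ℚ) v)) := by
  refine mk_eq_add_of_sub_sub_mem (dlog_merge_mem_relations (c := u) (c' := v) _ _ _
    (hR 1 (n:ℚ) (u + v) one_pos).1
    (hR 1 (n:ℚ) u one_pos).1 (hR 1 (n:ℚ) v one_pos).1 ?_ ?_ ?_)
  · rw [(hR 1 (n:ℚ) (u + v) one_pos).2]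
    exact fun _ _ => rfl
  · rw [(hR 1 (n:ℚ) u one_pos).2]
    exact fun _ _ => rfl
  · rw [(hR 1 (n:ℚ) v one_pos).2]
    exact fun _ _ => rfl

/-- **`ℤ`-linearity of the carriers**: `[Λ(n, k • u)] = k • [Λ(n, u)]` for `k ∈ ℤ`.
[cite: KontsevichZagier2001, §1.2 rule (1)] -/
theorem carrier_zsmul
    (hR : ∀ a b c, 0 < a → (R a b c).domain = {x | x 0 ∈ Set.Ioo (a:ℝ) b} ∧
      (R a b c).integrand = fun x => (c:ℝ) / x 0)
    (n : ℕ) (k : ℤ) (u : ℚ) :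
    QuotientAddGroup.mk' relations (of (R 1 (n:ℚ) (k • u))) =
      k • QuotientAddGroup.mk' relations (of (R 1 (n:ℚ) u)) :=
  map_zsmul (AddMonoidHom.mk' (fun u => QuotientAddGroup.mk' relations (of (R 1 (n:ℚ) u)))
    (carrier_add hR n)) k u

end Moves

/-! ## The registered sub-goal -/

/-- **`nf_pole_one`** (registered sub-goal of crux stmt-KontsevichZagierPeriods-3869, line
`SketchIdeator1`, leaf `stub_boxRigidity`, split-denominator layer in dimension one; explicit /
elementary route). A simple rational pole off `[0,1]`, `T = [(0,1), c/(x − ρ)]` (`c, ρ ∈ ℚ`,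
`ρ ∉ [0,1]`), is in the normal form "rational point + prime carriers" modulo `KZ.relations`:
there are `r ∈ ℚ`, a finite set of primes `S` and coefficients `C : ℕ → ℚ` supported on `S` with
`[T] = [pt, r] + Σ_{p ∈ S} [(1,p), C_p/y]` in `FormalRep ⧸ relations`. Explicitly: `r = 0`; after
the affine move to `[(a,b), c'/y]` and clearing denominators `n_a = d a`, `n_b = d b`,
`S = primeFactors n_b ∪ primeFactors n_a` and `C_p = (v_p(n_b) − v_p(n_a))·c'`.
[cite: KontsevichZagier2001, §1.1, §1.2 rules (1), (2)] -/
theorem nf_pole_one {R : ℚ → ℚ → ℚ → IntegralRep 1} {Z : ℚ → IntegralRep 0}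
    (hR : ∀ a b c, 0 < a → (R a b c).domain = {x | x 0 ∈ Set.Ioo (a:ℝ) b} ∧
      (R a b c).integrand = fun x => (c:ℝ) / x 0)
    (hZ : ∀ r, (Z r).domain = univ ∧ (Z r).integrand = fun _ => (r:ℝ)) {c ρ : ℚ}
    (hρ : (ρ:ℝ) ∉ Set.Icc (0:ℝ) 1) (T : IntegralRep 1)
    (hTd : T.domain = {x | x 0 ∈ Set.Ioo (0:ℝ) 1})
    (hTi : EqOn T.integrand (fun x => (c:ℝ) / (x 0 - ρ)) T.domain) :
    ∃ (r : ℚ) (S : Finset ℕ) (C : ℕ → ℚ), (∀ p ∈ S, p.Prime) ∧ (∀ p, p ∉ S → C p = 0) ∧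
      QuotientAddGroup.mk' relations (of T) = QuotientAddGroup.mk' relations (of (Z r)) +
        ∑ p ∈ S, QuotientAddGroup.mk' relations (of (R 1 p (C p))) := by
  -- Step 1: one affine move to a dlog representation `[(a,b), c'/y]`, `0 < a < b`
  obtain ⟨a, b, c', ha, hab, hT⟩ :
      ∃ a b c' : ℚ, 0 < a ∧ a < b ∧ of T - of (R a b c') ∈ relations := by
    have hρ' : ρ < 0 ∨ 1 < ρ := by
      by_contra h
      rw [not_or, not_lt, not_lt] at h
      exact hρ ⟨by exact_mod_cast h.1, by exact_mod_cast h.2⟩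
    rcases hρ' with h | h
    · exact ⟨-ρ, 1 - ρ, c, neg_pos.mpr h, by linarith, pole_translate_mem_relations hR h T hTd hTi⟩
    · exact ⟨ρ - 1, ρ, -c, by linarith, by linarith, pole_reflect_mem_relations hR h T hTd hTi⟩
  -- Step 2: clear denominators, `[(a,b), c'/y] ≡ [(n_a, n_b), c'/y]`
  obtain ⟨d, na, nb, hd, hna, hnb⟩ := exists_nat_clear_denominators ha (ha.trans hab)
  have hd0 : (0:ℚ) < d := Nat.cast_pos.mpr hd
  have hna0 : (0:ℚ) < na := by rw [hna]; exact mul_pos hd0 ha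
  have hnalt : (na:ℚ) < nb := by rw [hna, hnb]; exact mul_lt_mul_of_pos_left hab hd0
  have hna_ne : na ≠ 0 := by rintro rfl; exact absurd hna0 (by norm_num)
  have hnb_ne : nb ≠ 0 := by
    rintro rfl
    exact absurd (hna0.trans hnalt) (by norm_num)
  have hscale : of (R a b c') - of (R (na:ℚ) (nb:ℚ) c') ∈ relations := by
    refine dlog_scale_mem_relations (c := c') (s := (d:ℚ)) _ _ (hR a b c' ha).1 ?_ ?_ ?_ ha hd0
    · rw [(hR (na:ℚ) (nb:ℚ) c' hna0).1, hna, hnb]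
    · rw [(hR a b c' ha).2]
      exact fun _ _ => rfl
    · rw [(hR (na:ℚ) (nb:ℚ) c' hna0).2]
      exact fun _ _ => rfl
  -- Step 3: split at the integers, `[(n_a,n_b)] = Λ(n_b) − Λ(n_a)`
  have hsplit : of (R 1 (nb:ℚ) c') - of (R 1 (na:ℚ) c') - of (R (na:ℚ) (nb:ℚ) c') ∈ relations := by
    refine split_mem_relations _ _ _ (hR 1 (nb:ℚ) c' one_pos).1 (hR 1 (na:ℚ) c' one_pos).1
      (hR (na:ℚ) (nb:ℚ) c' hna0).1 ?_ ?_ ?_ ?_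
    · exact_mod_cast Nat.one_le_iff_ne_zero.mpr hna_ne
    · exact_mod_cast hnalt.le
    · rw [(hR 1 (na:ℚ) c' one_pos).2, (hR 1 (nb:ℚ) c' one_pos).2]
      exact fun _ _ => rfl
    · rw [(hR (na:ℚ) (nb:ℚ) c' hna0).2, (hR 1 (nb:ℚ) c' one_pos).2]
      exact fun _ _ => rfl
  -- the point carries nothing: `r = 0`
  have hZ0 : QuotientAddGroup.mk' relations (of (Z 0)) = 0 := by
    refine mk_eq_zero_of_mem (pt_zero_mem_relations (Z 0) ?_)
    rw [(hZ 0).2]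
    simp only [Rat.cast_zero]
  -- Step 4: the normal form
  set S : Finset ℕ := nb.primeFactors ∪ na.primeFactors with hS
  refine ⟨0, S, fun p => (((nb.factorization p : ℕ):ℤ) - ((na.factorization p : ℕ):ℤ)) • c',
    fun p hp => ?_, fun p hp => ?_, ?_⟩
  · rcases Finset.mem_union.mp hp with hp | hp <;> exact Nat.prime_of_mem_primeFactors hp
  · have hpb : nb.factorization p = 0 :=
      Finsupp.notMem_support_iff.mp fun h => hp (Finset.mem_union_left _ h)
    have hpa : na.factorization p = 0 :=
      Finsupp.notMem_support_iff.mp fun h => hp (Finset.mem_union_right _ h)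
    simp only [hpb, hpa, sub_self, zero_smul]
  · rw [hZ0, zero_add, mk_eq_mk_of_sub_mem hT, mk_eq_mk_of_sub_mem hscale,
      eq_sub_of_add_eq' (mk_eq_add_of_sub_sub_mem hsplit).symm,
      carrier_eq_sum_factorization hR c' nb hnb_ne S Finset.subset_union_left,
      carrier_eq_sum_factorization hR c' na hna_ne S Finset.subset_union_right,
      ← Finset.sum_sub_distrib]
    refine Finset.sum_congr rfl fun p _ => ?_
    rw [carrier_zsmul hR p _ c', sub_smul, natCast_zsmul, natCast_zsmul]

end K22

end Dlog

end Summit.KontsevichZagierPeriods.HurwitzMicroSectors.NormalFormPrinciple.PiBox
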